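import Summits.BirchSwinnertonDyer.BirchSwinnertonDyer.Theorems.BiquadraticEisensteinDescentHeegnerTwistCouplingInSupplyIndefinitePinWitness
import Summits.BirchSwinnertonDyer.BirchSwinnertonDyer.Theorems.BiquadraticEisensteinDescentHeegnerTwistCouplingInSupplyThreeSquaresPin
import Mathlib.Tactic.NormNum.LegendreSymbol
import HarnessLib

set_option linter.dupNamespace false -- `Summit.BirchSwinnertonDyer.BirchSwinnertonDyer.Theorems.…` (summit = sub)
set_option autoImplicit false

/-!
# Crux `HeegnerTwistCouplingInSupply` (stmt-BirchSwinnertonDyer-21381) — the `j = −3375` corner, part II: the SEVEN-P THREE-SQUARES PIN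
# (every prime `p ≡ 3 (mod 8)` has a prime `ℓ ≡ 1 (mod 4)` with `4ℓ < 7p`, `(ℓ/7) = −1`, `(ℓ/p) = −1`) and the witness field `ℚ(√−ℓ)`

Route `BiquadraticEisensteinDescent` (cell `pub/bsd-wall`, width seat `bsd-wall-cm-bed-w1` g11; `--supports` 21381, helper). The `j = 8000` and
`j = 1728` pins of the corner layer (`threeSquaresPin`: `2p = x²+y²+z²`; `pinThreeMinus_of_mod_eight_eq_five`: `p = u²+2v²+2w²`) read an auxiliary
prime off a represented integer and control TWO symbols (`ℓ mod 8`, `(ℓ/p)`). The `j = −3375` cell (`…SqrtSevenCell`) needs a THIRD one,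
`(ℓ/7) = −1` (every prime of the twisting integer must be inert in `ℚ(√−7)`), which no ternary pin forces by genus characters alone (cell bus,
bed-w2 g12 19:05Z). It is forced once `7` ENTERS THE REPRESENTED INTEGER: for `p ≡ 3 (mod 8)`, `7p ≡ 5 (mod 8)` is a sum of three squares
(tree theorem `Literature.NumberTheory.Waring.sum_three_squares_iff_mod_eight`), `7p = x² + y² + z²` with `z` odd; then `a = x² + y² = 7p − z²`
satisfies `(a/7) = (−z²/7) = −1`, so by multiplicativity some prime `ℓ` divides `a` to an ODD power with `(ℓ/7) = −1`; primes `≡ 3 (mod 4)` divide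
a sum of two squares to even powers (Fermat–Euler, Mathlib `Nat.eq_sq_add_sq_iff`), so `ℓ ≡ 1 (mod 4)`; `z² ≡ 7p (mod ℓ)` gives `(7p/ℓ) = 1`,
reciprocity at `ℓ ≡ 1 (mod 4)` gives `(7/ℓ) = (ℓ/7) = −1`, hence `(p/ℓ) = −1 = (ℓ/p)`; and `4ℓ ≤ a < 7p` (`a ≡ 4 (mod 8)`, `ℓ` odd). ALL THREE
symbols are automatic:

* §1 `exists_prime_dvd_of_legendreSym_seven` (the forcing), parity/`7`-adic bookkeeping;
* §2 ★ `sqrtSevenPin` — **∀ prime `p ≡ 3 (mod 8)`: ∃ prime `ℓ`, `ℓ ≡ 1 (mod 4)`, `4ℓ < 7p`, `(ℓ/7) = −1`, `(ℓ/p) = −1`** (with certificate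
  `exists_sevenP_certificate`);
* §3 the witness field `K′ = ℚ(√−ℓ)`: `d_{K′} = −4ℓ` (`isImaginaryQuadratic_and_discr_sqrtField_four_mul`), Heegner for every ODD level supported on
  `{7, p}` (`(−ℓ/7) = (−ℓ/p) = +1` as `p ≡ 3 (mod 4)`), `h(K′) < p` by the size lever of `…IndefinitePinWitness` (`4ℓ < 7p`, `p ≥ 23`), and
  ★ `exists_sqrtSevenPin_witnessField`.

HONEST FRAMING: elementary arithmetic (a Siegel-free small prime in a Chebotarev class of density `1/8`); nothing about `L`-values, Selmer groups,
the crux or BSD is asserted here. THEOREMS ONLY; supports stmt-BirchSwinnertonDyer-21381.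
-/

namespace Summit.BirchSwinnertonDyer.BirchSwinnertonDyer.Theorems.BiquadraticEisensteinDescentHeegnerTwistCouplingInSupplySqrtSevenPin

open Literature.NumberTheory.Waring Literature.NumberTheory.EllipticCurves
open Literature.NumberTheory.QuadraticFields Literature.NumberTheory.QuadraticFields.Quadratic
open Summit.BirchSwinnertonDyer.BirchSwinnertonDyer.Theorems.BiquadraticEisensteinDescentHeegnerTwistCouplingInSupplyIndefinitePinWitness
  (inv_pi_mul_sqrt_mul_log_lt_of_lt_mul)
open Summit.BirchSwinnertonDyer.BirchSwinnertonDyer.Theorems.BiquadraticEisensteinDescentHeegnerTwistCouplingInSupplySizeIndivisibleSharp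
  (classNumber_lt_of_sqrt_mul_log_lt)

/-! ## §1 Bookkeeping -/

/-- From a representation `x² + y² + z² = n` with `n ≡ 1 (mod 4)`, one with the LAST coordinate odd. [folklore] -/
theorem exists_sq_add_sq_add_odd_sq' {x y z n : ℕ} (h : x ^ 2 + y ^ 2 + z ^ 2 = n) (hn : n % 4 = 1) :
    ∃ a b c : ℕ, a ^ 2 + b ^ 2 + c ^ 2 = n ∧ c % 2 = 1 := by
  rcases Nat.even_or_odd z with ⟨k, rfl⟩ | hz
  · rcases Nat.even_or_odd y with ⟨m, rfl⟩ | hy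
    · rcases Nat.even_or_odd x with ⟨l, rfl⟩ | hx
      · exfalso
        have h4 : (l + l) ^ 2 + (m + m) ^ 2 + (k + k) ^ 2 = 4 * (l ^ 2 + m ^ 2 + k ^ 2) := by ring
        omega
      · exact ⟨m + m, k + k, x, by rw [← h]; ring, Nat.odd_iff.mp hx⟩
    · exact ⟨x, k + k, y, by rw [← h]; ring, Nat.odd_iff.mp hy⟩
  · exact ⟨x, y, z, h, Nat.odd_iff.mp hz⟩

/-- `7 ∣ x² + y² ⇒ 7 ∣ x ∧ 7 ∣ y` (`−1` is a non-residue modulo `7`). [folklore] -/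
theorem seven_dvd_of_seven_dvd_sq_add_sq {x y : ℕ} (h : 7 ∣ x ^ 2 + y ^ 2) : 7 ∣ x ∧ 7 ∣ y := by
  have key : ∀ a b : ZMod 7, a ^ 2 + b ^ 2 = 0 → a = 0 ∧ b = 0 := by decide
  have h0 : ((x : ZMod 7)) ^ 2 + ((y : ZMod 7)) ^ 2 = 0 := by
    have := (ZMod.natCast_eq_zero_iff (x ^ 2 + y ^ 2) 7).mpr h
    push_cast at this
    exact this
  obtain ⟨hx, hy⟩ := key _ _ h0
  exact ⟨(ZMod.natCast_eq_zero_iff x 7).mp hx, (ZMod.natCast_eq_zero_iff y 7).mp hy⟩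

/-- `legendreSym 7 2 = 1` and `legendreSym 7 (−1) = −1`. [folklore] -/
theorem legendreSym_seven_two_and_neg_one :
    @legendreSym 7 ⟨by norm_num⟩ 2 = 1 ∧ @legendreSym 7 ⟨by norm_num⟩ (-1) = -1 := by
  have h2 : ((2 : ℤ) : ZMod 7) ≠ 0 := by decide
  have h9 : ((2 : ℤ) : ZMod 7) = 3 * 3 := by decide
  haveI : Fact (Nat.Prime 7) := ⟨by norm_num⟩
  refine ⟨(legendreSym.eq_one_iff 7 h2).mpr ⟨3, h9⟩, ?_⟩
  rw [legendreSym.at_neg_one (by norm_num), ZMod.χ₄_nat_three_mod_four (by norm_num)]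

/-- **The forcing.** If `a = x² + y² ≠ 0`, `7 ∤ a` and `legendreSym 7 a = −1`, then some prime `ℓ ≡ 1 (mod 4)` with `(ℓ/7) = −1`
divides `a`: over the factorisation `a = ∏ q^{e_q}`, `legendreSym 7 a = ∏ (legendreSym 7 q)^{e_q}`; `q = 2` contributes `1`, a prime
`q ≡ 3 (mod 4)` has `e_q` even (Fermat–Euler), and if every `q ≡ 1 (mod 4)` had `(q/7) = +1` the product would be `+1`. [folklore] -/
theorem exists_prime_dvd_of_legendreSym_seven {a x y : ℕ} (hxy : x ^ 2 + y ^ 2 = a) (ha0 : a ≠ 0) (h7 : ¬ 7 ∣ a)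
    (hleg : @legendreSym 7 ⟨by norm_num⟩ a = -1) :
    ∃ ℓ : ℕ, ℓ.Prime ∧ ℓ ∣ a ∧ ℓ % 4 = 1 ∧ @legendreSym 7 ⟨by norm_num⟩ ℓ = -1 := by
  haveI : Fact (Nat.Prime 7) := ⟨by norm_num⟩
  by_contra! H
  have hsq := Nat.eq_sq_add_sq_iff.mp ⟨x, y, hxy.symm⟩
  have hprod : legendreSym 7 (a : ℤ) = 1 := by
    conv_lhs => rw [← Nat.prod_factorization_pow_eq_self ha0]
    rw [Finsupp.prod, Nat.support_factorization, Nat.cast_prod]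
    rw [show legendreSym 7 (∏ q ∈ a.primeFactors, ((q ^ a.factorization q : ℕ) : ℤ)) =
        ∏ q ∈ a.primeFactors, legendreSym 7 ((q ^ a.factorization q : ℕ) : ℤ) from map_prod (legendreSym.hom 7) _ _]
    refine Finset.prod_eq_one fun q hq => ?_
    have hqp : q.Prime := Nat.prime_of_mem_primeFactors hq
    have hqdvd : q ∣ a := Nat.dvd_of_mem_primeFactors hq
    rw [Nat.cast_pow, show legendreSym 7 ((q : ℤ) ^ a.factorization q) = legendreSym 7 q ^ a.factorization q from
      map_pow (legendreSym.hom 7) _ _]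
    have hq7 : q ≠ 7 := by rintro rfl; exact h7 hqdvd
    have hq0 : ((q : ℤ) : ZMod 7) ≠ 0 := by
      intro h
      have h' : ((q : ℕ) : ZMod 7) = 0 := by exact_mod_cast h
      rw [ZMod.natCast_eq_zero_iff] at h'
      exact hq7 ((Nat.prime_dvd_prime_iff_eq (by norm_num) hqp).mp h').symm
    have hpm : legendreSym 7 q = 1 ∨ legendreSym 7 q = -1 := by
      rcases legendreSym.eq_one_or_neg_one 7 hq0 with h | h
      · exact Or.inl h
      · exact Or.inr h
    by_cases h4 : q % 4 = 3
    · obtain ⟨k, hk⟩ : Even (a.factorization q) := by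
        rw [Nat.factorization_def a hqp]; exact hsq q hq h4
      rw [hk, ← two_mul, pow_mul, legendreSym.sq_one 7 hq0, one_pow]
    · by_cases h2 : q = 2
      · subst h2
        rw [show ((2 : ℕ) : ℤ) = 2 by norm_num, legendreSym_seven_two_and_neg_one.1, one_pow]
      · have hq1 : q % 4 = 1 := by
          have := hqp.eq_one_or_self_of_dvd 2
          have hodd := hqp.odd_of_ne_two h2
          rw [Nat.odd_iff] at hodd
          omega
        have h1 : legendreSym 7 q = 1 := hpm.resolve_right (H q hqp hqdvd hq1)
        rw [h1, one_pow]
  rw [hprod] at hleg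
  norm_num at hleg

/-! ## §2 The pin -/

/-- **The seven-p three-squares pin with its certificate.** For a prime `p ≡ 3 (mod 8)` there are `x y z ℓ : ℕ` with `x² + y² + z² = 7p`,
`z` odd, `ℓ` a prime `≡ 1 (mod 4)` with `(ℓ/7) = −1` dividing `x² + y²`; any such `ℓ` has `4ℓ < 7p` and `(ℓ/p) = −1`. [folklore] -/
theorem exists_sevenP_certificate {p : ℕ} (hp : p.Prime) (hp8 : p % 8 = 3) :
    ∃ x y z ℓ : ℕ, x ^ 2 + y ^ 2 + z ^ 2 = 7 * p ∧ z % 2 = 1 ∧ ℓ.Prime ∧ ℓ ∣ x ^ 2 + y ^ 2 ∧ ℓ % 4 = 1 ∧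
      jacobiSym (ℓ : ℤ) 7 = -1 ∧ 4 * ℓ < 7 * p ∧ jacobiSym (ℓ : ℤ) p = -1 := by
  haveI h7F : Fact (Nat.Prime 7) := ⟨by norm_num⟩
  have h4 : ¬ 4 ∣ 7 * p := by omega
  obtain ⟨x₀, y₀, z₀, h₀⟩ := (sum_three_squares_iff_mod_eight h4).mpr (by omega)
  obtain ⟨x, y, z, hxyz, hz⟩ := exists_sq_add_sq_add_odd_sq' h₀ (by omega)
  have hz8 : z ^ 2 % 8 = 1 :=
    Summit.BirchSwinnertonDyer.BirchSwinnertonDyer.Theorems.BiquadraticEisensteinDescentHeegnerTwistCouplingInSupplyThreeSquaresPin.sq_mod_eight_of_odd hz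
  set a := x ^ 2 + y ^ 2 with ha
  have ha8 : a % 8 = 4 := by omega
  have ha0 : a ≠ 0 := by omega
  -- `7 ∤ z` (else `49 ∣ 7p`), hence `7 ∤ a` and `legendreSym 7 a = legendreSym 7 (−z²) = −1`
  have h7z : ¬ 7 ∣ z := by
    intro h7z
    have h7a : 7 ∣ a := by
      have : 7 ∣ z ^ 2 := dvd_pow h7z two_ne_zero
      omega
    obtain ⟨hx, hy⟩ := seven_dvd_of_seven_dvd_sq_add_sq h7a
    have h49 : 49 ∣ x ^ 2 + y ^ 2 + z ^ 2 := by
      obtain ⟨x', rfl⟩ := hx; obtain ⟨y', rfl⟩ := hy; obtain ⟨z', rfl⟩ := h7z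
      exact ⟨x' ^ 2 + y' ^ 2 + z' ^ 2, by ring⟩
    rw [hxyz] at h49
    have : 7 ∣ p := by omega
    have := (Nat.prime_dvd_prime_iff_eq (by norm_num) hp).mp this
    omega
  have h7a : ¬ 7 ∣ a := by
    intro h
    obtain ⟨hx, hy⟩ := seven_dvd_of_seven_dvd_sq_add_sq h
    have : 7 ∣ z ^ 2 := by
      have h49 : 7 ∣ x ^ 2 + y ^ 2 := h
      omega
    exact h7z (Nat.Prime.dvd_of_dvd_pow (by norm_num) this)
  have hleg : legendreSym 7 (a : ℤ) = -1 := by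
    have hmod : (a : ℤ) % (7 : ℕ) = (-((z : ℤ) ^ 2)) % (7 : ℕ) := by
      have h1 : ((a : ℕ) : ℤ) + (z : ℤ) ^ 2 = 7 * (p : ℤ) := by exact_mod_cast hxyz
      have : (a : ℤ) = -((z : ℤ) ^ 2) + 7 * p := by linarith
      push_cast
      rw [this, Int.add_mul_emod_self_left]
    have key : legendreSym 7 (a : ℤ) = legendreSym 7 (-((z : ℤ) ^ 2)) := by
      rw [legendreSym.mod 7 (a : ℤ), hmod, ← legendreSym.mod]
    rw [key, show (-((z : ℤ) ^ 2)) = (-1) * (z : ℤ) ^ 2 by ring, legendreSym.mul,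
      legendreSym_seven_two_and_neg_one.2, legendreSym.sq_one' 7 (by
        intro h
        have h' : ((z : ℕ) : ZMod 7) = 0 := by exact_mod_cast h
        exact h7z ((ZMod.natCast_eq_zero_iff z 7).mp h'))]
    norm_num
  obtain ⟨ℓ, hℓ, hℓa, hℓ4, hℓ7⟩ := exists_prime_dvd_of_legendreSym_seven ha.symm ha0 h7a hleg
  -- size: `4ℓ ∣ a` (`ℓ` odd, `4 ∣ a`), `a < 7p`
  have h4a : 4 ∣ a := by omega
  have hℓodd : Nat.Coprime 4 ℓ := by
    have : Nat.Coprime 2 ℓ := (Nat.coprime_primes Nat.prime_two hℓ).mpr (by rintro rfl; omega)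
    exact Nat.Coprime.pow_left 2 this
  have h4ℓ : 4 * ℓ ∣ a := Nat.Coprime.mul_dvd_of_dvd_of_dvd hℓodd h4a hℓa
  have hle : 4 * ℓ ≤ a := Nat.le_of_dvd (by omega) h4ℓ
  have hz1 : 1 ≤ z ^ 2 := Nat.one_le_pow 2 z (by omega)
  have hlt : 4 * ℓ < 7 * p := by omega
  refine ⟨x, y, z, ℓ, hxyz, hz, hℓ, hℓa, hℓ4, ?_, hlt, ?_⟩
  · rw [← jacobiSym.legendreSym.to_jacobiSym]; exact hℓ7
  -- the symbol at `p`
  haveI : Fact p.Prime := ⟨hp⟩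
  haveI : Fact ℓ.Prime := ⟨hℓ⟩
  have hp2 : p ≠ 2 := by rintro rfl; omega
  have hℓ2 : ℓ ≠ 2 := by rintro rfl; omega
  have hℓp : ℓ ≠ p := by rintro rfl; omega
  have hℓ7' : ℓ ≠ 7 := by rintro rfl; omega
  -- `(7p : ZMod ℓ)` is a non-zero square: `z² ≡ 7p (mod ℓ)`
  have hcast : ((x ^ 2 + y ^ 2 + z ^ 2 : ℕ) : ZMod ℓ) = ((7 * p : ℕ) : ZMod ℓ) := by rw [hxyz]
  have hzero : ((x ^ 2 + y ^ 2 : ℕ) : ZMod ℓ) = 0 := (ZMod.natCast_eq_zero_iff _ _).mpr hℓa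
  push_cast at hcast hzero
  have hsq : IsSquare (((7 : ℤ) * (p : ℤ) : ℤ) : ZMod ℓ) := by
    refine ⟨(z : ZMod ℓ), ?_⟩
    push_cast
    linear_combination -hcast + hzero
  have hne : (((7 : ℤ) * (p : ℤ) : ℤ) : ZMod ℓ) ≠ 0 := by
    have hndvd : ¬ ℓ ∣ 7 * p := by
      intro h
      rcases (Nat.Prime.dvd_mul hℓ).mp h with h | h
      · exact hℓ7' ((Nat.prime_dvd_prime_iff_eq hℓ (by norm_num)).mp h)
      · exact hℓp ((Nat.prime_dvd_prime_iff_eq hℓ hp).mp h)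
    intro h
    apply hndvd
    apply (ZMod.natCast_eq_zero_iff (7 * p) ℓ).mp
    push_cast
    exact_mod_cast h
  have h1 : legendreSym ℓ ((7 : ℤ) * (p : ℤ)) = 1 := (legendreSym.eq_one_iff ℓ hne).mpr hsq
  have h7ℓ : legendreSym ℓ 7 = -1 := by
    have hrec := legendreSym.quadratic_reciprocity_one_mod_four (p := ℓ) (q := 7) hℓ4 (by norm_num)
    rw [hℓ7] at hrec
    exact_mod_cast hrec.symm
  rw [legendreSym.mul, h7ℓ] at h1
  have h2 : legendreSym ℓ p = -1 := by linarith
  rw [← jacobiSym.legendreSym.to_jacobiSym p, legendreSym.quadratic_reciprocity_one_mod_four (p := ℓ) (q := p) hℓ4 hp2, h2]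

/-- ★ **`sqrtSevenPin`.** For every prime `p ≡ 3 (mod 8)` there is a prime `ℓ ≡ 1 (mod 4)` with `4ℓ < 7p`, `(ℓ/7) = −1` (inert in `ℚ(√−7)`)
and `(ℓ/p) = −1` — the three symbols the `j = −3375` cell asks of its twisting prime, read off `7p − z²`. [folklore] -/
theorem sqrtSevenPin : ∀ p : ℕ, p.Prime → p % 8 = 3 →
    ∃ ℓ : ℕ, ℓ.Prime ∧ ℓ % 4 = 1 ∧ 4 * ℓ < 7 * p ∧ jacobiSym (ℓ : ℤ) 7 = -1 ∧ jacobiSym (ℓ : ℤ) p = -1 := by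
  intro p hp hp8
  obtain ⟨-, -, -, ℓ, -, -, hℓ, -, hℓ4, hJ7, hlt, hJ⟩ := exists_sevenP_certificate hp hp8
  exact ⟨ℓ, hℓ, hℓ4, hlt, hJ7, hJ⟩

/-! ## §3 The witness field `K′ = ℚ(√−ℓ)`, `ℓ ≡ 1 (mod 4)` prime: `d = −4ℓ`, Heegner for odd levels supported on `{7, p}`, `h < p` -/

section Witness

/-- `(ℓ/7) = −1` as residues: a natural number with `jacobiSym ℓ 7 = −1` is `≡ 3, 5, 6 (mod 7)`. [folklore] -/
theorem mod_seven_of_jacobiSym_eq_neg_one {ℓ : ℕ} (hJ : jacobiSym (ℓ : ℤ) 7 = -1) : ℓ % 7 = 3 ∨ ℓ % 7 = 5 ∨ ℓ % 7 = 6 := by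
  rw [jacobiSym.mod_left] at hJ
  have h : (ℓ : ℤ) % (7 : ℕ) = ((ℓ % 7 : ℕ) : ℤ) := by push_cast; rfl
  rw [h] at hJ
  have h7 : ℓ % 7 < 7 := Nat.mod_lt _ (by norm_num)
  interval_cases hm : ℓ % 7 <;> norm_num at hJ <;> simp

/-- `jacobiSym (−ℓ) 7 = 1` and `jacobiSym (−ℓ) p = 1` (`p ≡ 3 (mod 4)`) when `(ℓ/7) = (ℓ/p) = −1`: `7` and `p` split in `ℚ(√−ℓ)`. [folklore] -/
theorem jacobiSym_neg_eq_one {ℓ p : ℕ} (hp4 : p % 4 = 3) (hJ7 : jacobiSym (ℓ : ℤ) 7 = -1) (hJp : jacobiSym (ℓ : ℤ) p = -1) :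
    jacobiSym (-(ℓ : ℤ)) 7 = 1 ∧ jacobiSym (-(ℓ : ℤ)) p = 1 := by
  have h7 : jacobiSym (-1) 7 = -1 := by rw [jacobiSym.at_neg_one (by decide), ZMod.χ₄_nat_three_mod_four (by norm_num)]
  have hp : jacobiSym (-1) p = -1 := by
    rw [jacobiSym.at_neg_one (Nat.odd_iff.mpr (by omega)), ZMod.χ₄_nat_three_mod_four hp4]
  refine ⟨?_, ?_⟩
  · rw [show (-(ℓ : ℤ)) = (-1) * ℓ by ring, jacobiSym.mul_left, h7, hJ7]; norm_num
  · rw [show (-(ℓ : ℤ)) = (-1) * ℓ by ring, jacobiSym.mul_left, hp, hJp]; norm_num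

/-- `jacobiSym (−4ℓ) r = jacobiSym (−ℓ) r` for odd `r`. [folklore] -/
theorem jacobiSym_neg_four_mul {ℓ r : ℕ} (hr : r % 2 = 1) : jacobiSym (-(4 * (ℓ : ℤ))) r = jacobiSym (-(ℓ : ℤ)) r := by
  have hg : Int.gcd (2 : ℤ) (r : ℤ) = 1 := by
    have : Nat.Coprime 2 r := Nat.coprime_two_left.mpr (Nat.odd_iff.mpr hr)
    exact_mod_cast this
  rw [show (-(4 * (ℓ : ℤ))) = 2 ^ 2 * (-(ℓ : ℤ)) by ring, jacobiSym.mul_left, jacobiSym.sq_one' hg, one_mul]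

/-- **The witness field `K′ = ℚ(√−ℓ)`** for a prime `ℓ ≡ 1 (mod 4)`: imaginary quadratic with `d_{K′} = −4ℓ`, and Heegner for every level `N`
all of whose prime divisors `r` are odd with `(−ℓ/r) = +1`. [cite: Marcus2018, Ch. 2 Thm. 1 and Ch. 3 Thm. 25] [cite: GrossLMS1991, §1] -/
theorem witnessField_neg (ℓ : ℕ) (hℓ : ℓ.Prime) (hℓ4 : ℓ % 4 = 1) {N : ℕ}
    (hN : ∀ r : ℕ, r.Prime → r ∣ N → r % 2 = 1 ∧ jacobiSym (-(ℓ : ℤ)) r = 1) :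
    ∃ (K : Type) (_ : Field K) (_ : NumberField K),
      IsImaginaryQuadratic K ∧ NumberField.discr K = -(4 * (ℓ : ℤ)) ∧ SatisfiesHeegnerHypothesis N K := by
  haveI : Fact ((-(ℓ : ℤ)) < 0) := ⟨by have := hℓ.two_le; omega⟩
  have hsf : Squarefree (-(ℓ : ℤ)) := Int.squarefree_natAbs.mp (by rw [Int.natAbs_neg, Int.natAbs_natCast]; exact hℓ.squarefree)
  obtain ⟨hK, hdK⟩ := isImaginaryQuadratic_and_discr_sqrtField_four_mul (-(ℓ : ℤ)) (by omega) hsf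
  have hdK' : NumberField.discr (sqrtField (-(ℓ : ℤ))) = -(4 * (ℓ : ℤ)) := by rw [hdK]; ring
  refine ⟨sqrtField (-(ℓ : ℤ)), inferInstance, inferInstance, hK, hdK', ?_⟩
  rw [satisfiesHeegnerHypothesis_iff_kronecker N (sqrtField (-(ℓ : ℤ))) (sqrtField.finrank_eq_two _), hdK']
  intro r hr hrN
  obtain ⟨hr2, hJ⟩ := hN r hr hrN
  exact ⟨fun h => by omega, fun _ => by rw [jacobiSym_neg_four_mul hr2, hJ]⟩

/-- `h(ℚ(√−ℓ)) < p` from the class number formula bound when `4ℓ < 7p` and `p ≥ 23` (size lever of `…IndefinitePinWitness` with `c = 7`, `P = 23`).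
[cite: Oesterle1988Gauss, II §3 Proposition p. 57 (27)] -/
theorem classNumber_lt_of_four_mul_lt {ℓ p : ℕ} (hℓ : ℓ.Prime) (hlt : 4 * ℓ < 7 * p) (h23 : 23 ≤ p) :
    ∀ (K : Type) [Field K] [NumberField K], IsImaginaryQuadratic K → NumberField.discr K = -(4 * (ℓ : ℤ)) →
      NumberField.classNumber K < p := by
  intro K _ _ hK hdK
  have habs : (NumberField.discr K).natAbs = 4 * ℓ := by
    rw [hdK, Int.natAbs_neg, show (4 * (ℓ : ℤ)) = ((4 * ℓ : ℕ) : ℤ) by push_cast; ring, Int.natAbs_natCast]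
  have h4 : 4 < (NumberField.discr K).natAbs := by rw [habs]; have := hℓ.two_le; omega
  refine classNumber_lt_of_sqrt_mul_log_lt hK h4 ?_
  rw [habs]
  exact inv_pi_mul_sqrt_mul_log_lt_of_lt_mul (c := 7) (P := 23) (by have := hℓ.pos; positivity)
    (by exact_mod_cast hlt) (by norm_num) (by norm_num) (by exact_mod_cast h23)

/-- ★ **The pin with its witness field, `p ≥ 23`.** For a prime `p ≡ 3 (mod 8)` (`p ≥ 23`) and a level `N` supported on `{7, p}`: a prime `ℓ ≡ 1 (mod 4)`,
`ℓ ≡ 3, 5, 6 (mod 7)`, `(ℓ/p) = −1`, `ℓ ≠ p`, and `K′ = ℚ(√−ℓ)` imaginary quadratic with `d = −4ℓ`, Heegner for `N`, `h(K′) < p`. [folklore] -/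
theorem exists_sqrtSevenPin_witnessField {p : ℕ} (hp : p.Prime) (hp8 : p % 8 = 3) (h23 : 23 ≤ p) {N : ℕ}
    (hN : ∀ r : ℕ, r.Prime → r ∣ N → r = 7 ∨ r = p) :
    ∃ (ℓ : ℕ) (K : Type) (_ : Field K) (_ : NumberField K),
      ℓ.Prime ∧ ℓ % 4 = 1 ∧ (ℓ % 7 = 3 ∨ ℓ % 7 = 5 ∨ ℓ % 7 = 6) ∧ jacobiSym (ℓ : ℤ) p = -1 ∧ ℓ ≠ p ∧ 4 * ℓ < 7 * p ∧
      IsImaginaryQuadratic K ∧ NumberField.discr K = -(4 * (ℓ : ℤ)) ∧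
      SatisfiesHeegnerHypothesis N K ∧ NumberField.classNumber K < p := by
  obtain ⟨ℓ, hℓ, hℓ4, hlt, hJ7, hJ⟩ := sqrtSevenPin p hp hp8
  obtain ⟨h7, hp'⟩ := jacobiSym_neg_eq_one (by omega) hJ7 hJ
  obtain ⟨K, iF, iN, hK, hdK, hH⟩ := witnessField_neg ℓ hℓ hℓ4 (N := N) fun r hr hrN => by
    rcases hN r hr hrN with rfl | rfl
    · exact ⟨by norm_num, h7⟩
    · exact ⟨by omega, hp'⟩
  exact ⟨ℓ, K, iF, iN, hℓ, hℓ4, mod_seven_of_jacobiSym_eq_neg_one hJ7, hJ, by rintro rfl; omega, hlt, hK, hdK, hH,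
    classNumber_lt_of_four_mul_lt hℓ hlt h23 K hK hdK⟩

/-- `h(ℚ(√−13)) = 2` (discriminant `−52`). [cite: Cox2013, §2.A Thm. 2.13; §7.B Thm. 7.7(ii)] -/
theorem binQF_classNumber_neg52 : BinQF.classNumber (-52) = 2 := by decide +kernel

/-- ★ **The witness for `p = 19`** (the one prime `≡ 3, 19, 27 (mod 56)` below `23` other than `3`): `ℓ = 13` (`13 ≡ 1 (mod 4)`, `(13/7) = (13/19) = −1`,
`4·13 < 7·19`), `K′ = ℚ(√−13)`, `d = −52`, `h = 2 < 19`. [folklore] -/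
theorem exists_sqrtSevenPin_witnessField_nineteen {N : ℕ} (hN : ∀ r : ℕ, r.Prime → r ∣ N → r = 7 ∨ r = 19) :
    ∃ (ℓ : ℕ) (K : Type) (_ : Field K) (_ : NumberField K),
      ℓ.Prime ∧ ℓ % 4 = 1 ∧ (ℓ % 7 = 3 ∨ ℓ % 7 = 5 ∨ ℓ % 7 = 6) ∧ jacobiSym (ℓ : ℤ) 19 = -1 ∧ ℓ ≠ 19 ∧ 4 * ℓ < 7 * 19 ∧
      IsImaginaryQuadratic K ∧ NumberField.discr K = -(4 * (ℓ : ℤ)) ∧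
      SatisfiesHeegnerHypothesis N K ∧ NumberField.classNumber K < 19 := by
  have hJ7 : jacobiSym ((13 : ℕ) : ℤ) 7 = -1 := by norm_num
  have hJ : jacobiSym ((13 : ℕ) : ℤ) 19 = -1 := by norm_num
  obtain ⟨h7, hp'⟩ := jacobiSym_neg_eq_one (by norm_num) hJ7 hJ
  obtain ⟨K, iF, iN, hK, hdK, hH⟩ := witnessField_neg 13 (by norm_num) (by norm_num) (N := N) fun r hr hrN => by
    rcases hN r hr hrN with rfl | rfl
    · exact ⟨by norm_num, h7⟩
    · exact ⟨by norm_num, hp'⟩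
  refine ⟨13, K, iF, iN, by norm_num, by norm_num, by norm_num, hJ, by norm_num, by norm_num, hK, hdK, hH, ?_⟩
  rw [ClassNumberValues.classNumber_eq_of_discr_eq hK.1 hdK (by norm_num) (h := 2) (by exact_mod_cast binQF_classNumber_neg52)]
  norm_num

end Witness

end Summit.BirchSwinnertonDyer.BirchSwinnertonDyer.Theorems.BiquadraticEisensteinDescentHeegnerTwistCouplingInSupplySqrtSevenPin
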